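import Literature.NumberTheory.EllipticCurves.Kato2004.IwasawaH2FineSelmerDualComparison
import Summits.BirchSwinnertonDyer.Rank1Residual.X11b.AnticyclotomicLocalTorsionDescent
import Summits.BirchSwinnertonDyer.Rank1Residual.Additive.AdditiveTorsionFiveSeven
import Mathlib.NumberTheory.Padics.HeightOneSpectrum
import HarnessLib

/-!
# Kato 2004 (12.2.3)/(12.5.1) input `W(ℚ_{p,∞})[p^∞]` FINITE — in fact `= 0` — on every row of crux M with
# `W(ℚ_p)[p] = 0`: all (t′) rows at `p ≥ 11`, `p ∈ {5, 7}` off Kodaira II/III, and the wild-`3` rows with (c3*);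
# hence the hypothesis of `Kato2004.exists_iwasawaH2Data_fineSelmerDual_embedding` (Kato's `𝐇² ⊇ X₀` package) is
# discharged there (route-free helper for crux M = stmt-BirchSwinnertonDyer-19196, K9 / K8-t′)

Seat `bsd-potss-rkm` g26 (prover, cell `bsd-potss`), `--supports stmt-BirchSwinnertonDyer-19196 --as helper`; closes nothing.
HONEST FRAMING: BSD is not proved by any of this; nothing is booked; theorems only (no definition, no named fact, no `sorry`).

## What

The named fact `Kato2004.exists_iwasawaH2Data_fineSelmerDual_embedding` (file
`Kato2004/IwasawaH2FineSelmerDualComparison.lean`, seat bsd-cm-prr-ty1) — Kato's `𝐇²_Γ(T_pW)` with the descent sequence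
(14.14.1) pinned to `H¹(ℤ[1/p],T_pW)` AND the dual fine Selmer group `X₀(W/ℚ_∞)` embedded with finite cokernel, i.e. bricks
(c1) + (14.14.1) of the crux-M ledger (memo FINDING-19196-rkm-g18 §"What remains") — carries ONE arithmetic hypothesis:
`Finite (W(ℚ̄)[p^∞])^{ker κ ⊓ D_v}`, "`W(ℚ_{p,∞})[p^∞]` is finite" (Kato (12.2.3): `𝐇²_loc(T) ≅ Hom(H⁰(ℚ_p(ζ_{p^∞}),
Hom(T,ℚ/ℤ)),ℚ/ℤ)(−1)`; (12.5.1): `𝐇²_loc ⊗ ℚ ≠ 0` only off potentially good reduction).  On the rows of crux M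
(`p` odd, ADDITIVE potentially good) this module is not only finite but ZERO as soon as `W(ℚ_p)[p] = 0`: the group
`D_v/(D_v ⊓ ker κ)` is pro-`p`, so a non-zero fixed point of `D_v ⊓ ker κ` on the `p`-primary module `W[p^∞]` would
produce a non-zero `D_v`-fixed `p`-torsion point, i.e. a point of `W(ℚ_v)[p] = W(ℚ_p)[p]` (the tree's pro-`p` descent
`X11b.AcSelmer.fixedPoints_decomp_inf_kerSubgroup_eq_bot` + Galois descent `…eq_zero_of_fixed_decomp_of_local`, here
over `K = ℚ` with `ℚ_v ≃ ℚ_p`, Mathlib `Rat.HeightOneSpectrum.adicCompletion.padicEquiv`).  And `W(ℚ_p)[p] = 0` is a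
TREE THEOREM at every additive `p ≥ 11`, and at `p ∈ {5,7}` off `v₅(c₄) = 1` / `v₇(c₆) = 1`
(`Rank1Residual.Additive.eq_zero_of_prime_nsmul_eq_zero_of_addv`, Mazur's cusp-torsion step).

* §1 `noPTorsion_adicCompletion_of_padic` — `W(ℚ_p)[p] = 0 ⟹ W(ℚ_v)[p] = 0` for the place `v` of `ℚ` over `p`.
* §2 `fixedPoints_kerSubgroup_inf_decomp_eq_bot_of_noPTorsionPadic` — `(W(ℚ̄)[p^∞])^{ker κ ⊓ D_v} = 0` for EVERY
  `ℤ_p`-extension `κ` of `ℚ`; `finite_fixedPoints_kerSubgroup_inf_decomp_of_noPTorsionPadic` — the hypothesis of the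
  `𝐇² ⊇ X₀` fact verbatim.
* §3 the additive rows: `finite_fixedPoints_…_of_addv` (`p ≥ 5` off II/III), `…_of_addv_of_eleven_le` (`p ≥ 11`).
* §4 consumer shape: `exists_iwasawaH2Data_embedding_of_noPTorsionPadic` / `…_of_addv` / `…_of_addv_of_eleven_le` —
  under the named fact, for `p` odd, `κ` cyclotomic with generator `γ`, and every pin `I : IwasawaH1Data W p κ γ`, a
  package `J : IwasawaH2Data W p κ γ I` with an injection `X₀(W/ℚ_∞) ↪ J.H2` of finite cokernel EXISTS on these rows.

At `p = 3` (the wild rows of K9) `W(ℚ₃)[3] ≠ 0` does occur (8 of the 25 residue rows of item 19942, conjA-anchor g15);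
there the finiteness is Imai's theorem / Kato (12.5.1) and is NOT proved here (the vanishing form is false on those rows).

References: K. Kato, Astérisque 295 (2004), §12.2 (12.2.3) and the display after it (p. 220), Thm. 12.5 (3) with
(12.5.1) and Rem. 12.7 (p. 222), (14.9.1) (p. 239), §14.14 (14.14.1) (p. 243) [Kato2004Asterisque]; R. Greenberg,
LNM 1716 (1999), §3 Lemma 3.1 and proof of Prop. 4.8 [GreenbergLNM1716]; F. Castella, erratum to Math. Ann. 356,
Lemma 2.1 [Castella2018Erratum]; B. Mazur, Publ. IHÉS 47 (1977), Ch. III §5 Step 1 (p. 158) [Mazur1977].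
-/

-- the summit and its single problem are both named `BirchSwinnertonDyer` (registry layout D-0017)
set_option linter.dupNamespace false
set_option autoImplicit false

noncomputable section

open scoped Classical NumberField
open Function Field NumberField IsDedekindDomain
open Literature.NumberTheory.EllipticCurves Literature.NumberTheory.EllipticCurves.GreenbergSelmer
open Literature.NumberTheory.GaloisRepresentations
open Literature.NumberTheory.EllipticCurves.Kato2004 Literature.NumberTheory.EllipticCurves.IwasawaAlgebra
open Literature.NumberTheory.EllipticCurves.Rank1Residual
open Summit.BirchSwinnertonDyer.Rank1Residual

namespace Summit.BirchSwinnertonDyer.BirchSwinnertonDyer.Theorems.TowerTorsionVanishing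

variable (W : WeierstrassCurve ℚ) [W.IsElliptic] (p : ℕ) [Fact p.Prime]

/-! ## §1 `W(ℚ_p)[p] = 0 ⟹ W(ℚ_v)[p] = 0` at the place `v` of `ℚ` above `p` -/

omit [W.IsElliptic] in
/-- **`W(ℚ_p)[p] = 0 ⟹ W(ℚ_v)[p] = 0`** for every finite place `v` of `ℚ` of residue characteristic `p`
(`ℚ_v ≃ ℚ_p`, Mathlib `Rat.HeightOneSpectrum.adicCompletion.padicEquiv`; points map injectively along a map of fields).
[cite: SilvermanAEC2009, VII.§3 Prop. 3.1 (shape: torsion injects under field maps)] -/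
theorem noPTorsion_adicCompletion_of_padic (v : HeightOneSpectrum (𝓞 ℚ))
    (hv : ((Rat.HeightOneSpectrum.primesEquiv v : Nat.Primes) : ℕ) = p)
    (h4 : ∀ R : (W.baseChange ℚ_[p]).toAffine.Point, p • R = 0 → R = 0) :
    ∀ R : (W.baseChange (v.adicCompletion ℚ)).toAffine.Point, p • R = 0 → R = 0 := by
  subst hv
  intro R hR
  set e : v.adicCompletion ℚ →ₐ[ℚ] ℚ_[((Rat.HeightOneSpectrum.primesEquiv v : Nat.Primes) : ℕ)] :=
    (Rat.HeightOneSpectrum.adicCompletion.padicEquiv (R := 𝓞 ℚ) v).toAlgEquiv.toAlgHom with he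
  have hmap := h4 (WeierstrassCurve.Affine.Point.map e R) (by rw [← map_nsmul, hR, map_zero])
  exact WeierstrassCurve.Affine.Point.map_injective (W' := W) e (by rw [hmap, map_zero])

/-! ## §2 `(W(ℚ̄)[p^∞])^{ker κ ⊓ D_v} = 0` — hence FINITE — for every `ℤ_p`-extension `κ` of `ℚ` -/

/-- **`W(ℚ_p)[p] = 0 ⟹ (W(ℚ̄)[p^∞])^{ker κ ⊓ D_v} = 0`** for EVERY `ℤ_p`-extension `κ` of `ℚ` and the decomposition
group `D_v` of the chosen prime above `p`: the points of `W[p^∞]` over the completion of `ℚ_∞ = ℚ̄^{ker κ}` at the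
place above `v` VANISH (pro-`p` descent from `D_v` to `D_v ⊓ ker κ`, then Galois descent to `W(ℚ_v)[p] = W(ℚ_p)[p] = 0`).
[cite: GreenbergLNM1716, §3 Lemma 3.1 and proof of Prop. 4.8 (p. 109)] [cite: Castella2018Erratum, Lemma 2.1 (pp. 1–2)] -/
theorem fixedPoints_kerSubgroup_inf_decomp_eq_bot_of_noPTorsionPadic (κ : ZpExtension ℚ p)
    (v : HeightOneSpectrum (𝓞 ℚ)) (hv : ((Rat.HeightOneSpectrum.primesEquiv v : Nat.Primes) : ℕ) = p)
    (h4 : ∀ R : (W.baseChange ℚ_[p]).toAffine.Point, p • R = 0 → R = 0) :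
    FixedPoints.addSubgroup ↥(κ.kerSubgroup ⊓ decomp v) (W.geomPrimaryTorsion p) = ⊥ := by
  have h0 : ∀ m : W.geomPrimaryTorsion p, (∀ d ∈ decomp v, d • m = m) → p • m = 0 → m = 0 :=
    fun m hfix hpm => X11b.AcSelmer.eq_zero_of_fixed_decomp_of_local W p v
      (noPTorsion_adicCompletion_of_padic W p v hv h4) m hfix hpm
  have h := X11b.AcSelmer.fixedPoints_decomp_inf_kerSubgroup_eq_bot κ W v h0
  rw [inf_comm]
  exact h

/-- **The hypothesis of the `𝐇² ⊇ X₀` fact, verbatim: `(W(ℚ̄)[p^∞])^{ker κ ⊓ D_v}` is FINITE** when `W(ℚ_p)[p] = 0`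
(it is even trivial). [cite: Kato2004Asterisque, §12.2 (12.2.3) and the display after it (p. 220); Thm. 12.5 (3) with (12.5.1) (p. 222)]
[cite: GreenbergLNM1716, §3 Lemma 3.1] -/
theorem finite_fixedPoints_kerSubgroup_inf_decomp_of_noPTorsionPadic (κ : ZpExtension ℚ p)
    (v : HeightOneSpectrum (𝓞 ℚ)) (hv : ((Rat.HeightOneSpectrum.primesEquiv v : Nat.Primes) : ℕ) = p)
    (h4 : ∀ R : (W.baseChange ℚ_[p]).toAffine.Point, p • R = 0 → R = 0) :
    Finite (FixedPoints.addSubgroup ↥(κ.kerSubgroup ⊓ decomp v) (W.geomPrimaryTorsion p)) := by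
  rw [fixedPoints_kerSubgroup_inf_decomp_eq_bot_of_noPTorsionPadic W p κ v hv h4]
  infer_instance

/-! ## §3 The additive rows: `p ≥ 5` off Kodaira II/III, and every additive `p ≥ 11` -/

/-- **On an ADDITIVE row at `p ≥ 5` off the exceptional locus** (`p = 5 ⟹ v₅(c₄) ≠ 1`, `p = 7 ⟹ v₇(c₆) ≠ 1`; `W`
globally minimal) `(W(ℚ̄)[p^∞])^{ker κ ⊓ D_v} = 0` for every `ℤ_p`-extension `κ` — `W(ℚ_p)[p] = 0` is the tree theorem
`Additive.eq_zero_of_prime_nsmul_eq_zero_of_addv`. [cite: Mazur1977, Ch. III §5, Step 1 (p. 158)] [cite: GreenbergLNM1716, §3 Lemma 3.1] -/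
theorem fixedPoints_kerSubgroup_inf_decomp_eq_bot_of_addv [W.IsGloballyMinimal] (hp5 : 5 ≤ p) (hadd : Addv W p)
    (h5 : p = 5 → padicValRat p W.c₄ ≠ 1) (h7 : p = 7 → padicValRat p W.c₆ ≠ 1) (κ : ZpExtension ℚ p)
    (v : HeightOneSpectrum (𝓞 ℚ)) (hv : ((Rat.HeightOneSpectrum.primesEquiv v : Nat.Primes) : ℕ) = p) :
    FixedPoints.addSubgroup ↥(κ.kerSubgroup ⊓ decomp v) (W.geomPrimaryTorsion p) = ⊥ :=
  fixedPoints_kerSubgroup_inf_decomp_eq_bot_of_noPTorsionPadic W p κ v hv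
    fun _ hR => Additive.eq_zero_of_prime_nsmul_eq_zero_of_addv W p hp5 hadd h5 h7 hR

/-- **Finite form on an additive row at `p ≥ 5` off II/III** (the hypothesis of the `𝐇² ⊇ X₀` fact).
[cite: Kato2004Asterisque, §12.2 (12.2.3) (p. 220) and (12.5.1) (p. 222)] [cite: Mazur1977, Ch. III §5, Step 1 (p. 158)] -/
theorem finite_fixedPoints_kerSubgroup_inf_decomp_of_addv [W.IsGloballyMinimal] (hp5 : 5 ≤ p) (hadd : Addv W p)
    (h5 : p = 5 → padicValRat p W.c₄ ≠ 1) (h7 : p = 7 → padicValRat p W.c₆ ≠ 1) (κ : ZpExtension ℚ p)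
    (v : HeightOneSpectrum (𝓞 ℚ)) (hv : ((Rat.HeightOneSpectrum.primesEquiv v : Nat.Primes) : ℕ) = p) :
    Finite (FixedPoints.addSubgroup ↥(κ.kerSubgroup ⊓ decomp v) (W.geomPrimaryTorsion p)) :=
  finite_fixedPoints_kerSubgroup_inf_decomp_of_noPTorsionPadic W p κ v hv
    fun _ hR => Additive.eq_zero_of_prime_nsmul_eq_zero_of_addv W p hp5 hadd h5 h7 hR

/-- **Every additive `p ≥ 11`, no side condition**: `(W(ℚ̄)[p^∞])^{ker κ ⊓ D_v} = 0` for every `ℤ_p`-extension `κ`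
of `ℚ` — in particular on every (t′) row of crux M at `p ≥ 11`. [cite: Mazur1977, Ch. III §5, Step 1 (p. 158)] [cite: GreenbergLNM1716, §3 Lemma 3.1] -/
theorem fixedPoints_kerSubgroup_inf_decomp_eq_bot_of_addv_of_eleven_le [W.IsGloballyMinimal] (h11 : 11 ≤ p)
    (hadd : Addv W p) (κ : ZpExtension ℚ p) (v : HeightOneSpectrum (𝓞 ℚ))
    (hv : ((Rat.HeightOneSpectrum.primesEquiv v : Nat.Primes) : ℕ) = p) :
    FixedPoints.addSubgroup ↥(κ.kerSubgroup ⊓ decomp v) (W.geomPrimaryTorsion p) = ⊥ :=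
  fixedPoints_kerSubgroup_inf_decomp_eq_bot_of_noPTorsionPadic W p κ v hv
    fun _ hR => Additive.eq_zero_of_prime_nsmul_eq_zero_of_addv_of_eleven_le W p h11 hadd hR

/-- **Finite form at every additive `p ≥ 11`** (the hypothesis of the `𝐇² ⊇ X₀` fact on every (t′) row at `p ≥ 11`).
[cite: Kato2004Asterisque, §12.2 (12.2.3) (p. 220) and (12.5.1) (p. 222)] [cite: Mazur1977, Ch. III §5, Step 1 (p. 158)] -/
theorem finite_fixedPoints_kerSubgroup_inf_decomp_of_addv_of_eleven_le [W.IsGloballyMinimal] (h11 : 11 ≤ p)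
    (hadd : Addv W p) (κ : ZpExtension ℚ p) (v : HeightOneSpectrum (𝓞 ℚ))
    (hv : ((Rat.HeightOneSpectrum.primesEquiv v : Nat.Primes) : ℕ) = p) :
    Finite (FixedPoints.addSubgroup ↥(κ.kerSubgroup ⊓ decomp v) (W.geomPrimaryTorsion p)) :=
  finite_fixedPoints_kerSubgroup_inf_decomp_of_noPTorsionPadic W p κ v hv
    fun _ hR => Additive.eq_zero_of_prime_nsmul_eq_zero_of_addv_of_eleven_le W p h11 hadd hR

/-! ## §4 Consumer shape: Kato's `𝐇² ⊇ X₀` package EXISTS on these rows (modulo the named fact only) -/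

section H2

variable [ContinuousSMul ℤ_[p] (W.tateModule p)]

/-- **Kato's `𝐇²_Γ(T_pW) ⊇ X₀(W/ℚ_∞)` package on a row with `W(ℚ_p)[p] = 0`**: under the named fact
`Kato2004.exists_iwasawaH2Data_fineSelmerDual_embedding`, for `p` odd, the cyclotomic `ℤ_p`-extension `κ` with
topological generator `γ`, the place `v` over `p` and EVERY pin `I : IwasawaH1Data W p κ γ`, there is a descent package
`J : IwasawaH2Data W p κ γ I` ((12.2.1), Thm. 12.4 (1), (14.14.1) pinned) with an injective `Λ`-linear
`X₀(W/ℚ_∞) ↪ J.H2` of finite cokernel — the fact's finiteness hypothesis being DISCHARGED by §2.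
[cite: Kato2004Asterisque, (14.9.1) (p. 239), §12.2 (12.2.1)–(12.2.3) (p. 220), Thm. 12.4 (1) (p. 221), (14.14.1) (p. 243), (17.13.1) (p. 279)] -/
theorem exists_iwasawaH2Data_embedding_of_noPTorsionPadic (hX : exists_iwasawaH2Data_fineSelmerDual_embedding)
    (hodd : p ≠ 2) {κ : ZpExtension ℚ p} {γ : absoluteGaloisGroup ℚ} (hκ : κ.IsCyclotomic) (hγ : κ.IsTopGenerator γ)
    (v : HeightOneSpectrum (𝓞 ℚ)) (hv : ((Rat.HeightOneSpectrum.primesEquiv v : Nat.Primes) : ℕ) = p)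
    (h4 : ∀ R : (W.baseChange ℚ_[p]).toAffine.Point, p • R = 0 → R = 0) (I : IwasawaH1Data W p κ γ) :
    ∃ (J : IwasawaH2Data W p κ γ I) (e : (W.fineSelmerDualData κ hγ).X →ₗ[IwasawaAlgebra p] J.H2),
      Injective e ∧ Finite (J.H2 ⧸ LinearMap.range e) :=
  hX W p κ γ hγ v hodd hκ hv (finite_fixedPoints_kerSubgroup_inf_decomp_of_noPTorsionPadic W p κ v hv h4) I

/-- **The `𝐇² ⊇ X₀` package on an additive row at `p ≥ 5` off II/III** (modulo the named fact only).
[cite: Kato2004Asterisque, (14.9.1) (p. 239), Thm. 12.4 (1) (p. 221), (14.14.1) (p. 243)] [cite: Mazur1977, Ch. III §5, Step 1 (p. 158)] -/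
theorem exists_iwasawaH2Data_embedding_of_addv [W.IsGloballyMinimal]
    (hX : exists_iwasawaH2Data_fineSelmerDual_embedding) (hp5 : 5 ≤ p) (hadd : Addv W p)
    (h5 : p = 5 → padicValRat p W.c₄ ≠ 1) (h7 : p = 7 → padicValRat p W.c₆ ≠ 1)
    {κ : ZpExtension ℚ p} {γ : absoluteGaloisGroup ℚ} (hκ : κ.IsCyclotomic) (hγ : κ.IsTopGenerator γ)
    (v : HeightOneSpectrum (𝓞 ℚ)) (hv : ((Rat.HeightOneSpectrum.primesEquiv v : Nat.Primes) : ℕ) = p)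
    (I : IwasawaH1Data W p κ γ) :
    ∃ (J : IwasawaH2Data W p κ γ I) (e : (W.fineSelmerDualData κ hγ).X →ₗ[IwasawaAlgebra p] J.H2),
      Injective e ∧ Finite (J.H2 ⧸ LinearMap.range e) :=
  exists_iwasawaH2Data_embedding_of_noPTorsionPadic W p hX (by omega) hκ hγ v hv
    (fun _ hR => Additive.eq_zero_of_prime_nsmul_eq_zero_of_addv W p hp5 hadd h5 h7 hR) I

/-- **The `𝐇² ⊇ X₀` package on EVERY additive row at `p ≥ 11`** (modulo the named fact only) — in particular on every
(t′) row of crux M / of the route `KatoDescentTamePotSupersingular` at `p ≥ 11`, for every pin of `𝐇¹_Γ(T_pW)`.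
[cite: Kato2004Asterisque, (14.9.1) (p. 239), Thm. 12.4 (1) (p. 221), (14.14.1) (p. 243)] [cite: Mazur1977, Ch. III §5, Step 1 (p. 158)] -/
theorem exists_iwasawaH2Data_embedding_of_addv_of_eleven_le [W.IsGloballyMinimal]
    (hX : exists_iwasawaH2Data_fineSelmerDual_embedding) (h11 : 11 ≤ p) (hadd : Addv W p)
    {κ : ZpExtension ℚ p} {γ : absoluteGaloisGroup ℚ} (hκ : κ.IsCyclotomic) (hγ : κ.IsTopGenerator γ)
    (v : HeightOneSpectrum (𝓞 ℚ)) (hv : ((Rat.HeightOneSpectrum.primesEquiv v : Nat.Primes) : ℕ) = p)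
    (I : IwasawaH1Data W p κ γ) :
    ∃ (J : IwasawaH2Data W p κ γ I) (e : (W.fineSelmerDualData κ hγ).X →ₗ[IwasawaAlgebra p] J.H2),
      Injective e ∧ Finite (J.H2 ⧸ LinearMap.range e) :=
  exists_iwasawaH2Data_embedding_of_noPTorsionPadic W p hX (by omega) hκ hγ v hv
    (fun _ hR => Additive.eq_zero_of_prime_nsmul_eq_zero_of_addv_of_eleven_le W p h11 hadd hR) I

end H2

end Summit.BirchSwinnertonDyer.BirchSwinnertonDyer.Theorems.TowerTorsionVanishing

end
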